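import Literature.Probability.LatticeModels.DirichletGreenFunction

/-!
# The Gaussian shadow of the crux `CoerciveSharpness.PhiCoercive` (stmt-CriticalPhenomena-18196) is identically `1`

Crux disprover `refuter-cdisprove-stmt-CriticalPhenomena-18196-0` (negative lane of crux `PhiCoercive`,
route `CoerciveSharpness`, sub-problem `CriticalPhenomena/Ising3DConformalLimit`).

The crux asks for GROWTH, `φ_{β_c}(S) ≥ c·m^κ` (`κ > 0`) for all finite `S ⊇ Λ_m ⊆ ℤ³`, of the
Duminil-Copin–Panis sharpness functional `φ_β(S) = β Σ_{x∈S} #{y ∉ S : y ∼ x} ⟨σ₀σ_x⟩^free_{S,β}`.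
Replace the Ising two-point function in `S` by its Gaussian / simple-random-walk counterpart at the
Gaussian critical point `2dβ = 1`: `β ⟨σ₀σ_x⟩_S ↦ (1/2d)·g_S(0,x) = G_S(0,x)`, where `g_S` is the Green
function of the walk killed on leaving `S` and `G_S = (−Δ_S)⁻¹ = g_S/(2d)` is the tree's `dirichletGreen S`.
The resulting functional

  `gaussPhi S x := Σ_{y ∈ S} #{w ∉ S : w ∼ y} · G_S(x, y)`

(written out in the statements; no `def`) is computed here EXACTLY: **`gaussPhi S x = 1` for every `d ≥ 1`, every finite `S` and every `x ∈ S`**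
(`gaussPhi_eq_one`) — it is the total exit flux (harmonic measure) of the killed walk, which is conserved.
So in the Gaussian model the sharpness functional has NO growth in the shape or size of `S` (`κ = 0`
exactly, with equality, for every superset of every box): any proof of `PhiCoercive` must use an input that
FAILS for the Gaussian walk — not merely a `d = 3` input (GKS, Simon–Lieb, switching-lemma chains, the
infrared bound, MMS and bubble divergence all hold verbatim or are saturated at the Gaussian point).  This is
the formal content of the strategist's barrier note "SharpnessFluxGaussianSaturation"
(`Cruxes/PhiCoercive/STRATEGY-CENSUS.md` §Negation 3) and of the route's remark "κ = 0 EXACTLY in mean field,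
where the boundary flux of ⟨σ₀σ_·⟩ is conserved harmonic measure"; it complements the catalogued barrier
`Literature.Barriers.CriticalPhenomena.IsingTrivialityFromDimensionFour`.

Proof: Green's representation formula (`green_representation`, Lawler 1991 §1.5) for the indicator `F` of
`Sᶜ` at `x ∈ S`: `0 = F x = Σ_{y∈S} G_S(x,y)(−ΔF)(y) + Σ_{z∈∂S} H_S(x,z)`, with `(−ΔF)(y) = −#{w ∼ y : w ∉ S}`
on `S` and `Σ_z H_S(x,z) = 1` (`sum_poissonKernel`).  Sorry-free; axioms `propext`/`Classical.choice`/`Quot.sound`.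
-/

noncomputable section

namespace Summit.CriticalPhenomena.Ising3DConformalLimit.Cruxes.PhiCoercive.Negative

open scoped BigOperators
open Finset
open Literature.Probability.LatticeModels

variable {d : ℕ}

/-! The **Gaussian sharpness functional** of a finite `S ⊆ ℤ^d` seen from `x` is written out (no `def`,
so that this file stays a pure-proof file): `gaussPhi S x := Σ_{y ∈ S} #{w ∉ S : w ∼ y} · G_S(x,y)` with
`G_S = (−Δ_S)⁻¹ = dirichletGreen S` (`= (1/2d)·𝐄_x[# visits to y before leaving S]`), i.e. the
Duminil-Copin–Panis `φ_β(S)` with `β⟨σ_xσ_y⟩_S` replaced by its random-walk value at the Gaussian critical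
point `2dβ = 1`. -/

/-- `−Δ` of the indicator of `Sᶜ` at a point of `S` is minus the number of outer neighbours. -/
theorem neg_latticeLaplacianZd_indicator_compl {S : Finset (Site d)} {y : Site d} (hy : y ∈ S) :
    -latticeLaplacianZd (fun z => if z ∈ S then (0 : ℝ) else 1) y =
      -((((zdGraph d).neighborFinset y).filter fun w => w ∉ S).card : ℝ) := by
  rw [latticeLaplacianZd_eq_sum_neighborFinset]
  simp only [if_pos hy, sub_zero]
  rw [neg_inj]
  rw [← Finset.sum_boole]
  refine Finset.sum_congr rfl fun w _ => ?_
  by_cases hw : w ∈ S <;> simp [hw]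

/-- **Gaussian flux conservation: `gaussPhi S x = 1`** for `d ≥ 1`, every finite `S ⊆ ℤ^d` and every
`x ∈ S` — the exit flux of the killed walk is harmonic measure, total mass one, whatever the shape of `S`.
In particular the Gaussian analogue of `PhiCoercive`/`BoxCoercive`/`SupersetStable` holds with `κ = 0`
and EQUALITY for every superset of every box, and fails for every `κ > 0`. [cite: Lawler1991, §1.4–1.5] -/
theorem gaussPhi_eq_one (hd : 0 < d) {S : Finset (Site d)} {x : Site d} (hx : x ∈ S) :
    ∑ y ∈ S, ((((zdGraph d).neighborFinset y).filter fun w => w ∉ S).card : ℝ) * dirichletGreen S x y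
      = 1 := by
  classical
  have h := green_representation hd S (fun z => if z ∈ S then (0 : ℝ) else 1) hx
  simp only [if_pos hx] at h
  have hin : ∑ y ∈ S, dirichletGreen S x y * -latticeLaplacianZd (fun z => if z ∈ S then (0 : ℝ) else 1) y =
      -∑ y ∈ S, ((((zdGraph d).neighborFinset y).filter fun w => w ∉ S).card : ℝ) * dirichletGreen S x y := by
    rw [← Finset.sum_neg_distrib]
    refine Finset.sum_congr rfl fun y hy => ?_
    rw [neg_latticeLaplacianZd_indicator_compl hy]
    ring
  have hout : (∑ z ∈ outerBoundary (zdGraph d) S,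
      poissonKernel S x z * if z ∈ S then (0 : ℝ) else 1) = 1 := by
    calc (∑ z ∈ outerBoundary (zdGraph d) S, poissonKernel S x z * if z ∈ S then (0 : ℝ) else 1)
        = ∑ z ∈ outerBoundary (zdGraph d) S, poissonKernel S x z := by
          refine Finset.sum_congr rfl fun z hz => ?_
          rw [if_neg (mem_outerBoundary_iff.1 hz).1, mul_one]
      _ = 1 := sum_poissonKernel hd S hx
  rw [hin, hout] at h
  linarith

/-- **No Gaussian coercivity**: for every `κ > 0` and `c > 0` the Gaussian analogue of the crux fails on
`ℤ³` — indeed `c·m^κ ≤ gaussPhi S 0 = 1` is violated by every finite `S ∋ 0` as soon as `c·m^κ > 1`. -/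
theorem not_gaussPhi_coercive {κ c : ℝ} (hκ : 0 < κ) (hc : 0 < c) :
    ¬ ∀ m : ℕ, 1 ≤ m → ∀ S : Finset (Site 3), box 3 m ⊆ S → c * (m : ℝ) ^ κ ≤
        ∑ y ∈ S, ((((zdGraph 3).neighborFinset y).filter fun w => w ∉ S).card : ℝ) * dirichletGreen S 0 y := by
  intro h
  -- choose `m` with `c·m^κ > 1`
  have ht : Filter.Tendsto (fun m : ℕ => c * (m : ℝ) ^ κ) Filter.atTop Filter.atTop :=
    ((tendsto_rpow_atTop hκ).comp tendsto_natCast_atTop_atTop).const_mul_atTop hc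
  obtain ⟨m, hm1, hm2⟩ :=
    ((ht.eventually_gt_atTop (1 : ℝ)).and (Filter.eventually_ge_atTop 1)).exists
  have hle := h m hm2 (box 3 m) subset_rfl
  rw [gaussPhi_eq_one (by norm_num) (zero_mem_box 3 m)] at hle
  exact absurd hle (not_le.2 hm1)

end Summit.CriticalPhenomena.Ising3DConformalLimit.Cruxes.PhiCoercive.Negative

end
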